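import Summits.QuantumFields.BalabanUV.Beta.KernelWardLevels
import Summits.QuantumFields.BalabanUV.Beta.CoDressedMmRead
import Summits.QuantumFields.BalabanUV.Beta.GAN24.MultiplierVertexBondSum

/-!
# `BalabanUV.Beta.KernelWardMColumn` — binder row D1, the W-side socket (L4) of the Ward binder hW: THE MULTIPLIER-COLUMN WARD LAW
# (the multiplier columns `colM` of the step propagators are CO-CLOSED in both slots, at every level; hence the multiplier-column
# vertex `vertexOfM`, the multiplier half of the unfolded first-order vertex `dM`, and the EXCHANGED mixed term of the second-order
# carrier `W2OfK` have ZERO pure-gauge divergence)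
# (β sub-cell, lineage an1 = «direct one-loop in Bałaban's gauge», gen 27; twin of leaf-07's `KernelWardHColumn` for the multiplier rows)

NOT IN PRINT; OUR BOOKKEEPING.  HONEST FRAMING (cell contract, verbatim): «discharging `BetaPertH` makes Bałaban's UV stability
UNCONDITIONAL — a real constructive-QFT result; it is NOT the continuum limit and NOT the Clay problem.»  HONEST DEPENDENCY (verbatim):
«continuum YM on T⁴ ⇐ BetaPertH ∧ nine spine estimates (0/9 proved); BetaPertH ⇐ (D1) ∧ (D4) ∧ CAP+tail; G-an2-4 gates asym, D1 and
NE2/3/4.»  This module is [folklore] linear algebra over tree objects BY NAME; it types no statement of Bałaban's papers, carries no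
`[cite:]` tag and no `Prop` fact, instantiates NO binder of the β-function wall, and is NOT D1, NOT `BetaPertH`, NOT continuum, NOT Clay.

## What is proved, and where it sits

After `KernelWardLevels` / leaf-05's `KernelWardLevelsWilson` / leaf-10's `WardLocusInduction`–`WardLocusRecursive` and an2's decision
(L3-D′), BOTH binders of row D1 (hW and hR) hang on the W-SIDE SOCKETS (L4) only: a Ward divergence law `hWd` (resp. a reflection law)
for the W-tables of the wall literal.  The supplier's W-tables are an2's second-order carrier `SecondOrderResponse.W2OfK K N S M S₂ M₂`
(`W2OfK_apply`: `vertex2OfK + mixOfK μ y ν y′ + mixOfK ν y′ μ y + dM (K2OfK … ν y′) N S M μ y`) over the wall's own step propagators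
`G_j := coDressKBmAt ρ_c Lc (KInvStep Lc j)`.  Its coarse divergence in the first bond `(μ, y)` meets, besides the field rows `colH` of the
`(μ, y)`-column of `G_j` (leaf-07's ℋ-column Ward law `KernelWardHColumn*.colH_ward_*`: `Σ_μ ∇_μ colH = c_H · gaugeWt`), the MULTIPLIER
rows `SecondOrderResponse.colM G_j Lc μ y ρ w` — through `vertexOfM` (inside `dM`) and through the exchanged mixed term
`mixOfK G_j Lc M₂ ν y′ μ y`.  THIS FILE supplies their Ward law, which is HOMOGENEOUS (no gauge-weight source):

* §1 `wΦ_ward_source` / `wΦ_ward_resp`: an2's co-closedness of the multiplier response `wΦ` (`BorderedHessian.codiff₁_wΦ_right`,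
  `codiff₁_wΦ_shift`, file `ValueHessianBlind`) rewritten as the two finite-difference identities
  `Σ_μ (wΦ ρ μ (w − (y − e_μ)) − wΦ ρ μ (w − y)) = 0` and `Σ_ρ (wΦ ρ μ (w − e_ρ − y) − wΦ ρ μ (w − y)) = 0`.
* §2 THE MULTIPLIER-COLUMN WARD LAW at every level, for the one-shot resolvent `KInv`, the straight step propagator `KInvStep Lc j` and the
  co-dressed wall propagator `coDressKBmAt ρ Lc (KInvStep Lc j)` (any root `ρ`):
  `Σ_μ (colM K Lc μ (y − e_μ) ρ′ w − colM K Lc μ y ρ′ w) = 0` (SOURCE slot: the multiplier response to a coarse pure-gauge background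
  vanishes — coarse gauge invariance of the blocked quadratic form) and `Σ_ρ′ (colM K Lc μ y ρ′ (w − e_ρ′) − colM K Lc μ y ρ′ w) = 0`
  (RESPONSE slot) — read through `GAN24.MultiplierZeroMass.colM_KInvStep` (the `mm`-block of the step propagator at the `Lc`-dilated points IS
  `wΦ` at blocking `Lc^{j+1}`) and `AxialDressingRooted.coDressKBmAt_inr_inr` (co-dressing does not touch the `mm`-block).  No new
  relative-inverse (AME) computation is needed for the multiplier rows.
* §3 CONSEQUENCES FOR THE CARRIER (generic packed kernel `K`: decaying, with the source-slot law as hypothesis `hM0`; bounded tables):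
  `divV (vertexOfM K N M) y = 0` (`divV_vertexOfM_eq_zero`); `divV (dM K N S M) y = divV (vertexOfK K N S) y` (`divV_dM`), so an1's FILE-1
  law `KernelWardRelative.divV_vertexOfK_eq_conjV` holds verbatim for the UNFOLDED first-order vertex `dM` (`divV_dM_eq_conjV`); and the
  (W-L4) PIECE LAW for the exchanged mixed term: `divW (fun μ y ν y′ ↦ mixOfK K N M₂ ν y′ μ y) y ν y′ = 0` (`divW_mixOfK_swap_eq_zero`).
* §4 the instances for `KInvStep Lc j` and `coDressKBmAt (toSite r) Lc (KInvStep Lc j)`, every `j`, every in-block root `r`.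

DIFFERENT from leaf-14's `GAN24.MultiplierZeroMass` / `MultiplierVertexBondSum` (zero MASS / zero BOND SUM of `colM` / `vertexOfM`:
constant-mode statements of the W-slot road W3); here the statements are DIVERGENCE (pure-gauge) laws.  What this file does NOT do: the
other three pieces of `divW (W2OfK …)` (`vertex2OfK`, the direct mixed term, the response term `dM (K2OfK …)`), which need the bare
background-divergence laws of the second-order tables `S₂` / `M₂` (statement-level, toy first) — see an1's `SKELETON-D1-L4`.
-/

noncomputable section

open Finset
open scoped BigOperators
open Literature.MathematicalPhysics.QuantumFieldTheory
open Literature.MathematicalPhysics.QuantumFieldTheory.Balaban1983to89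
open Literature.MathematicalPhysics.QuantumFieldTheory.Balaban1983to89.Beta
open B12Sec2to5 (l1 l1_nonneg)
open B6BondElimination (unitVec unitVec_apply)
open ExpKernelCalculus (MKer Decays BiLoc comp Zl summable_exp_shift' tsum_exp_shift')
open KernelWard (divV divW)
open KernelSpecInstance (wΦ)
open AffineAveraging (Site box toSite codiff₁)
open AveragingWardStencils (b6UnitVec_eq)
open OneStepResolventKernel (Fib KInv wsum LocStencil)
open OneStepKernelFamily (KInvStep colH vertexOfK decays_KInvStep)
open InterLevelTransport (cwsum cwsum_apply)
open SecondOrderResponse (colM colM_KInv vertexOfM dM mixOfK)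
open Summit.QuantumFields.BalabanUV.Beta.TameKernelCalculus
open Summit.QuantumFields.BalabanUV.Beta.ChartConjugation (conjV)
open Summit.QuantumFields.BalabanUV.Beta.ChartConjugationReflection (summable_abs_colH)
open Summit.QuantumFields.BalabanUV.Beta.BorderedHessian (codiff₁_wΦ_right codiff₁_wΦ_shift)
open Summit.QuantumFields.BalabanUV.Beta.AxialDressingRooted (coDressKBmAt coDressKBmAt_inr_inr decays_coDressKBmAt_KInvStep)
open Summit.QuantumFields.BalabanUV.Beta.KernelWardRelative (gaugeWt divV_vertexOfK_eq_conjV)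
open Summit.QuantumFields.BalabanUV.Beta.GAN24.MultiplierZeroMass (colM_KInvStep)
open Summit.QuantumFields.BalabanUV.Beta.GAN24.MultiplierVertexBondSum (abs_colM_le_fine)

namespace Summit.QuantumFields.BalabanUV.Beta.KernelWardMColumn

variable {d : ℕ}

/-! ## §1 The multiplier response `wΦ` is co-closed in both slots, as finite-difference identities -/

section OneShot

variable {N : ℕ} [NeZero N]

/-- [folklore] **SOURCE-SLOT CO-CLOSEDNESS OF `wΦ`** (an2's `codiff₁_wΦ_right`, pointwise):
`Σ_μ (wΦ ρ μ (w − (y − e_μ)) − wΦ ρ μ (w − y)) = 0` — the multiplier response to a coarse pure gauge at the site `y` vanishes. -/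
theorem wΦ_ward_source (ρ : Fin (d + 1)) (w y : Site (d + 1)) :
    ∑ μ, (wΦ (N := N) ρ μ (w - (y - unitVec μ)) - wΦ (N := N) ρ μ (w - y)) = 0 := by
  have h := congrFun (codiff₁_wΦ_right (N := N) (d := d) ρ w) y
  rw [Pi.zero_apply] at h
  simp only [codiff₁] at h
  simp only [b6UnitVec_eq]
  exact h

/-- [folklore] **RESPONSE-SLOT CO-CLOSEDNESS OF `wΦ`** (an2's `codiff₁_wΦ_shift`, pointwise):
`Σ_ρ (wΦ ρ μ (w − e_ρ − y) − wΦ ρ μ (w − y)) = 0` — the multiplier response to any source is a co-closed coarse one-form. -/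
theorem wΦ_ward_resp (μ : Fin (d + 1)) (w y : Site (d + 1)) :
    ∑ ρ, (wΦ (N := N) ρ μ (w - unitVec ρ - y) - wΦ (N := N) ρ μ (w - y)) = 0 := by
  have h := congrFun (codiff₁_wΦ_shift (N := N) (d := d) μ y) w
  rw [Pi.zero_apply] at h
  simp only [codiff₁] at h
  simp only [b6UnitVec_eq]
  exact h

/-- [folklore] **THE MULTIPLIER-COLUMN WARD LAW FOR THE ONE-SHOT RESOLVENT, SOURCE SLOT**:
`Σ_μ (colM KInv N μ (y − e_μ) ρ w − colM KInv N μ y ρ w) = 0` (`colM_KInv`: the multiplier column of `KInv` is `wΦ ρ μ (w − y)`). -/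
theorem colM_KInv_ward (y : Site (d + 1)) (ρ : Fin (d + 1)) (w : Site (d + 1)) :
    ∑ μ, (colM (KInv (N := N)) N μ (y - unitVec μ) ρ w - colM (KInv (N := N)) N μ y ρ w) = 0 := by
  simp only [colM_KInv]
  exact wΦ_ward_source ρ w y

/-- [folklore] **THE MULTIPLIER-COLUMN WARD LAW FOR THE ONE-SHOT RESOLVENT, RESPONSE SLOT**:
`Σ_ρ (colM KInv N μ y ρ (w − e_ρ) − colM KInv N μ y ρ w) = 0`. -/
theorem colM_KInv_ward_resp (μ : Fin (d + 1)) (y w : Site (d + 1)) :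
    ∑ ρ, (colM (KInv (N := N)) N μ y ρ (w - unitVec ρ) - colM (KInv (N := N)) N μ y ρ w) = 0 := by
  simp only [colM_KInv]
  exact wΦ_ward_resp μ w y

end OneShot

/-! ## §2 The step propagators, every level `j`: straight `KInvStep Lc j` and co-dressed `coDressKBmAt ρ Lc (KInvStep Lc j)` -/

section Step

variable {Lc : ℕ} [NeZero Lc]

/-- [folklore] **CO-DRESSING DOES NOT TOUCH THE MULTIPLIER COLUMNS** (`coDressKBmAt_inr_inr`: the `mm`-block of the co-dressed kernel is
that of `K`). -/
theorem colM_coDressKBmAt (ρ : Site (d + 1)) (N : ℕ) (K : MKer (d + 1) (Fib d)) (μ : Fin (d + 1)) (y : Site (d + 1))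
    (ρ' : Fin (d + 1)) (w : Site (d + 1)) : colM (coDressKBmAt ρ N K) N μ y ρ' w = colM K N μ y ρ' w :=
  coDressKBmAt_inr_inr ρ N K _ _ _ _

/-- [folklore] **THE MULTIPLIER-COLUMN WARD LAW FOR THE STEP PROPAGATOR, SOURCE SLOT, EVERY LEVEL**:
`Σ_μ (colM (KInvStep Lc j) Lc μ (y − e_μ) ρ w − colM (KInvStep Lc j) Lc μ y ρ w) = 0` — the `mm`-block of `KInvStep Lc j` at the
`Lc`-dilated points is `wΦ` at blocking `Lc^{j+1}` (`GAN24.MultiplierZeroMass.colM_KInvStep`), which is co-closed (§1). -/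
theorem colM_KInvStep_ward (j : ℕ) (y : Site (d + 1)) (ρ : Fin (d + 1)) (w : Site (d + 1)) :
    ∑ μ, (colM (KInvStep (d := d) Lc j) Lc μ (y - unitVec μ) ρ w - colM (KInvStep (d := d) Lc j) Lc μ y ρ w) = 0 := by
  simp only [colM_KInvStep]
  exact wΦ_ward_source ρ w y

/-- [folklore] **THE MULTIPLIER-COLUMN WARD LAW FOR THE STEP PROPAGATOR, RESPONSE SLOT, EVERY LEVEL**:
`Σ_ρ (colM (KInvStep Lc j) Lc μ y ρ (w − e_ρ) − colM (KInvStep Lc j) Lc μ y ρ w) = 0`. -/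
theorem colM_KInvStep_ward_resp (j : ℕ) (μ : Fin (d + 1)) (y w : Site (d + 1)) :
    ∑ ρ, (colM (KInvStep (d := d) Lc j) Lc μ y ρ (w - unitVec ρ) - colM (KInvStep (d := d) Lc j) Lc μ y ρ w) = 0 := by
  simp only [colM_KInvStep]
  exact wΦ_ward_resp μ w y

/-- [folklore] **THE MULTIPLIER-COLUMN WARD LAW FOR THE CO-DRESSED WALL PROPAGATOR `G_j`, SOURCE SLOT, EVERY LEVEL, ANY ROOT**:
`Σ_μ (colM G_j Lc μ (y − e_μ) ρ′ w − colM G_j Lc μ y ρ′ w) = 0` for `G_j := coDressKBmAt ρ Lc (KInvStep Lc j)`. -/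
theorem colM_coDressKBmAt_KInvStep_ward (ρ : Site (d + 1)) (j : ℕ) (y : Site (d + 1)) (ρ' : Fin (d + 1)) (w : Site (d + 1)) :
    ∑ μ, (colM (coDressKBmAt ρ Lc (KInvStep (d := d) Lc j)) Lc μ (y - unitVec μ) ρ' w
      - colM (coDressKBmAt ρ Lc (KInvStep (d := d) Lc j)) Lc μ y ρ' w) = 0 := by
  simp only [colM_coDressKBmAt]
  exact colM_KInvStep_ward j y ρ' w

/-- [folklore] **THE MULTIPLIER-COLUMN WARD LAW FOR THE CO-DRESSED WALL PROPAGATOR `G_j`, RESPONSE SLOT, EVERY LEVEL, ANY ROOT**. -/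
theorem colM_coDressKBmAt_KInvStep_ward_resp (ρ : Site (d + 1)) (j : ℕ) (μ : Fin (d + 1)) (y w : Site (d + 1)) :
    ∑ ρ', (colM (coDressKBmAt ρ Lc (KInvStep (d := d) Lc j)) Lc μ y ρ' (w - unitVec ρ')
      - colM (coDressKBmAt ρ Lc (KInvStep (d := d) Lc j)) Lc μ y ρ' w) = 0 := by
  simp only [colM_coDressKBmAt]
  exact colM_KInvStep_ward_resp j μ y w

end Step

/-! ## §3 Consequences for an2's carrier: `vertexOfM`, `dM` and the exchanged mixed term of `W2OfK` (generic packed kernel) -/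

section Carrier

variable {N : ℕ} [NeZero N]

/-- [folklore] The multiplier column of a decaying kernel is absolutely summable in its coarse position index. -/
theorem summable_abs_colM {K : MKer (d + 1) (Fib d)} (hK : ∃ δ C : ℝ, 0 < δ ∧ 0 ≤ C ∧ Decays K C δ) (μ : Fin (d + 1))
    (y : Site (d + 1)) (ρ : Fin (d + 1)) : Summable fun w => |colM K N μ y ρ w| := by
  obtain ⟨δ, C, hδ, -, hK⟩ := hK
  refine Summable.of_nonneg_of_le (fun w => abs_nonneg _) (fun w => abs_colM_le_fine (N := N) hK hδ.le μ y ρ w) ?_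
  exact (summable_exp_shift' hδ y).mul_left C

/-- [folklore] The total mass of the absolute multiplier column is at most `C · Zl(δ)`, uniformly in the bond `(μ, y)` and the slot `ρ`. -/
theorem tsum_abs_colM_le {K : MKer (d + 1) (Fib d)} {C δ : ℝ} (hK : Decays K C δ) (hδ : 0 < δ) (μ : Fin (d + 1))
    (y : Site (d + 1)) (ρ : Fin (d + 1)) : ∑' w, |colM K N μ y ρ w| ≤ C * Zl (d + 1) δ := by
  have hC : 0 ≤ C := hK.nonneg (Sum.inl 0)
  calc ∑' w, |colM K N μ y ρ w| ≤ ∑' w : Site (d + 1), C * Real.exp (-δ * l1 (w - y)) :=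
        Summable.tsum_le_tsum (fun w => abs_colM_le_fine (N := N) hK hδ.le μ y ρ w)
          (summable_abs_colM (N := N) ⟨δ, C, hδ, hC, hK⟩ μ y ρ) ((summable_exp_shift' hδ y).mul_left C)
    _ = C * Zl (d + 1) δ := by rw [tsum_mul_left, tsum_exp_shift']

/-- [folklore] **UNIFORM BOUND OF THE MULTIPLIER-COLUMN VERTEX** of a bounded table: `|vertexOfM K N M μ y x z a b| ≤ (d+1)·C·Zl(δ)·B`. -/
theorem abs_vertexOfM_le {K : MKer (d + 1) (Fib d)} {C δ : ℝ} (hK : Decays K C δ) (hδ : 0 < δ)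
    {M : Fin (d + 1) → Site (d + 1) → MKer (d + 1) (Fib d)} {B : ℝ} (hM : ∀ ρ w x z a b, |M ρ w x z a b| ≤ B)
    (μ : Fin (d + 1)) (y x z : Site (d + 1)) (a b : Fib d) :
    |vertexOfM K N M μ y x z a b| ≤ (d + 1 : ℕ) * (C * Zl (d + 1) δ * B) := by
  have hC : 0 ≤ C := hK.nonneg (Sum.inl 0)
  have hB : 0 ≤ B := (abs_nonneg _).trans (hM μ y x z a b)
  have hρ : ∀ ρ : Fin (d + 1), |∑' w, colM K N μ y ρ w * M ρ w x z a b| ≤ C * Zl (d + 1) δ * B := by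
    intro ρ
    have hs : Summable fun w => |colM K N μ y ρ w| * B := (summable_abs_colM (N := N) ⟨δ, C, hδ, hC, hK⟩ μ y ρ).mul_right B
    have hle : ∀ w, |colM K N μ y ρ w * M ρ w x z a b| ≤ |colM K N μ y ρ w| * B := fun w => by
      rw [abs_mul]
      exact mul_le_mul_of_nonneg_left (hM ρ w x z a b) (abs_nonneg _)
    have habs : Summable fun w => |colM K N μ y ρ w * M ρ w x z a b| :=
      Summable.of_nonneg_of_le (fun _ => abs_nonneg _) hle hs
    have hnorm : Summable fun w => ‖colM K N μ y ρ w * M ρ w x z a b‖ := by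
      simpa only [Real.norm_eq_abs] using habs
    calc |∑' w, colM K N μ y ρ w * M ρ w x z a b| ≤ ∑' w, |colM K N μ y ρ w * M ρ w x z a b| := by
          have h := norm_tsum_le_tsum_norm hnorm
          simpa only [Real.norm_eq_abs] using h
      _ ≤ ∑' w, |colM K N μ y ρ w| * B := Summable.tsum_le_tsum hle habs hs
      _ = (∑' w, |colM K N μ y ρ w|) * B := tsum_mul_right
      _ ≤ C * Zl (d + 1) δ * B := mul_le_mul_of_nonneg_right (tsum_abs_colM_le (N := N) hK hδ μ y ρ) hB
  simp only [vertexOfM, cwsum_apply]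
  calc |∑ ρ, ∑' w, colM K N μ y ρ w * M ρ w x z a b| ≤ ∑ ρ, |∑' w, colM K N μ y ρ w * M ρ w x z a b| :=
        Finset.abs_sum_le_sum_abs _ _
    _ ≤ ∑ _ρ : Fin (d + 1), C * Zl (d + 1) δ * B := Finset.sum_le_sum fun ρ _ => hρ ρ
    _ = (d + 1 : ℕ) * (C * Zl (d + 1) δ * B) := by
        rw [Finset.sum_const, Finset.card_univ, Fintype.card_fin, nsmul_eq_mul]

/-- [folklore] **THE MULTIPLIER-COLUMN VERTEX HAS ZERO PURE-GAUGE DIVERGENCE.**  For a decaying packed kernel whose multiplier columns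
obey the source-slot Ward law `hM0` (§2: every step propagator, straight or co-dressed) and any bounded multiplier table `M`:
`divV (vertexOfM K N M) y = 0` — the block bookkeeping of `KernelWardRelative.divV_vertexOfK` with `colM` in place of `colH`, and `0` in
place of the gauge weight. -/
theorem divV_vertexOfM_eq_zero {K : MKer (d + 1) (Fib d)} (hK : ∃ δ C : ℝ, 0 < δ ∧ 0 ≤ C ∧ Decays K C δ)
    (hM0 : ∀ (y : Site (d + 1)) (ρ : Fin (d + 1)) (w : Site (d + 1)),
      ∑ μ, (colM K N μ (y - unitVec μ) ρ w - colM K N μ y ρ w) = 0)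
    {M : Fin (d + 1) → Site (d + 1) → MKer (d + 1) (Fib d)} {B : ℝ} (hM : ∀ ρ w x z a b, |M ρ w x z a b| ≤ B)
    (y : Site (d + 1)) : divV (vertexOfM K N M) y = 0 := by
  have hs : ∀ (μ : Fin (d + 1)) (y' : Site (d + 1)) (ρ : Fin (d + 1)) (x z : Site (d + 1)) (a b : Fib d),
      Summable fun w => colM K N μ y' ρ w * M ρ w x z a b := fun μ y' ρ x z a b =>
    Summable.of_norm_bounded ((summable_abs_colM (N := N) hK μ y' ρ).mul_right B) (fun w => by
      rw [Real.norm_eq_abs, abs_mul]; exact mul_le_mul_of_nonneg_left (hM ρ w x z a b) (abs_nonneg _))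
  funext x z a b
  simp only [KernelWard.divV, Finset.sum_apply, Pi.sub_apply, Pi.zero_apply, vertexOfM, cwsum_apply]
  simp only [← Finset.sum_sub_distrib]
  rw [Finset.sum_comm]
  refine Finset.sum_eq_zero fun ρ _ => ?_
  have e : ∀ μ : Fin (d + 1), (∑' w, colM K N μ (y - unitVec μ) ρ w * M ρ w x z a b) - (∑' w, colM K N μ y ρ w * M ρ w x z a b)
      = ∑' w, (colM K N μ (y - unitVec μ) ρ w - colM K N μ y ρ w) * M ρ w x z a b := fun μ => by
    rw [← (hs μ _ ρ x z a b).tsum_sub (hs μ y ρ x z a b)]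
    exact tsum_congr fun w => by ring
  simp only [e]
  rw [← Summable.tsum_finsetSum (fun μ _ => (((hs μ (y - unitVec μ) ρ x z a b).sub (hs μ y ρ x z a b)).congr
    (fun w => by show _ - _ = _; ring)))]
  have e2 : ∀ w : Site (d + 1), ∑ μ, (colM K N μ (y - unitVec μ) ρ w - colM K N μ y ρ w) * M ρ w x z a b = 0 := fun w => by
    rw [← Finset.sum_mul, hM0 y ρ w, zero_mul]
  simp only [e2, tsum_zero]

/-- [folklore] The coarse divergence is additive in the vertex family. -/
theorem divV_add (V V' : Fin (d + 1) → Site (d + 1) → MKer (d + 1) (Fib d)) (y : Site (d + 1)) :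
    divV (fun μ y => V μ y + V' μ y) y = divV V y + divV V' y := by
  simp only [KernelWard.divV]
  rw [← Finset.sum_add_distrib]
  refine Finset.sum_congr rfl fun μ _ => ?_
  abel

/-- [folklore] **THE UNFOLDED FIRST-ORDER VERTEX HAS THE PURE-GAUGE DIVERGENCE OF ITS FIELD HALF**: `divV (dM K N S M) y = divV (vertexOfK K N S) y`
(`dM = vertexOfK + vertexOfM`, and the multiplier half is transversal). -/
theorem divV_dM {K : MKer (d + 1) (Fib d)} (hK : ∃ δ C : ℝ, 0 < δ ∧ 0 ≤ C ∧ Decays K C δ)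
    (hM0 : ∀ (y : Site (d + 1)) (ρ : Fin (d + 1)) (w : Site (d + 1)),
      ∑ μ, (colM K N μ (y - unitVec μ) ρ w - colM K N μ y ρ w) = 0)
    (S : Fin (d + 1) → Site (d + 1) → MKer (d + 1) (Fib d)) {M : Fin (d + 1) → Site (d + 1) → MKer (d + 1) (Fib d)} {B : ℝ}
    (hM : ∀ ρ w x z a b, |M ρ w x z a b| ≤ B) (y : Site (d + 1)) : divV (dM K N S M) y = divV (vertexOfK K N S) y := by
  rw [show dM K N S M = fun μ y => vertexOfK K N S μ y + vertexOfM K N M μ y from rfl, divV_add,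
    divV_vertexOfM_eq_zero (N := N) hK hM0 hM y, add_zero]

/-- [folklore] **THE FIRST-ORDER WARD LAW FOR THE UNFOLDED VERTEX** — an1's `KernelWardRelative.divV_vertexOfK_eq_conjV` VERBATIM for
`dM K N S M`: ℋ-column Ward law `hH` + block-stencil socket `hSd` for the field table `S` + the multiplier-column Ward law `hM0` ⇒
`divV (dM K N S M) y = conjV 𝕄 (X y)`. -/
theorem divV_dM_eq_conjV {K Mop : MKer (d + 1) (Fib d)} (hK : ∃ δ C : ℝ, 0 < δ ∧ 0 ≤ C ∧ Decays K C δ) (hN : 1 ≤ N)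
    (hM0 : ∀ (y : Site (d + 1)) (ρ : Fin (d + 1)) (w : Site (d + 1)),
      ∑ μ, (colM K N μ (y - unitVec μ) ρ w - colM K N μ y ρ w) = 0)
    {S : Fin (d + 1) → Site (d + 1) → MKer (d + 1) (Fib d)} {Cs δs : ℝ} (hS : LocStencil S Cs δs) (hδs : 0 < δs) (cH : ℝ)
    (hH : ∀ (y : Site (d + 1)) (κ' : Fin (d + 1)) (u : Site (d + 1)),
      ∑ μ, (colH K N μ (y - unitVec μ) κ' u - colH K N μ y κ' u) = cH * gaugeWt N y κ' u)
    {X : Site (d + 1) → MKer (d + 1) (Fib d)}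
    (hSd : ∀ y : Site (d + 1), cH • ∑ v ∈ box (d + 1) N, divV S ((N : ℤ) • y + toSite v) = conjV Mop (X y))
    {M : Fin (d + 1) → Site (d + 1) → MKer (d + 1) (Fib d)} {B : ℝ} (hM : ∀ ρ w x z a b, |M ρ w x z a b| ≤ B)
    (y : Site (d + 1)) : divV (dM K N S M) y = conjV Mop (X y) := by
  rw [divV_dM (N := N) hK hM0 S hM y]
  exact divV_vertexOfK_eq_conjV hK hN hS hδs cH hH hSd y

/-- [folklore] **THE (W-L4) PIECE LAW FOR THE EXCHANGED MIXED TERM OF `W2OfK`.**  The third summand of an2's second-order carrier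
(`W2OfK_apply`), `μ y ν y′ ↦ mixOfK K N M₂ ν y′ μ y` (field slot of the mixed table read through the `(ν, y′)`-column, multiplier slot through
the MULTIPLIER rows of the `(μ, y)`-column), has ZERO pure-gauge divergence in its first bond `(μ, y)`, for every bounded mixed table `M₂`:
`divW (fun μ y ν y′ ↦ mixOfK K N M₂ ν y′ μ y) y ν y′ = 0`.  (The `(μ, y)`-dependence sits in the inner multiplier-column vertices
`vertexOfM K N (M₂ κ u) μ y`, each transversal by `divV_vertexOfM_eq_zero`; the outer superposition with the absolutely summable
`colH`-weights is exchanged with the finite divergence sum.) -/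
theorem divW_mixOfK_swap_eq_zero {K : MKer (d + 1) (Fib d)} (hK : ∃ δ C : ℝ, 0 < δ ∧ 0 ≤ C ∧ Decays K C δ)
    (hM0 : ∀ (y : Site (d + 1)) (ρ : Fin (d + 1)) (w : Site (d + 1)),
      ∑ μ, (colM K N μ (y - unitVec μ) ρ w - colM K N μ y ρ w) = 0)
    {M₂ : Fin (d + 1) → Site (d + 1) → Fin (d + 1) → Site (d + 1) → MKer (d + 1) (Fib d)} {B : ℝ}
    (hM₂ : ∀ κ u ρ w x z a b, |M₂ κ u ρ w x z a b| ≤ B) (y : Site (d + 1)) (ν : Fin (d + 1)) (y' : Site (d + 1)) :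
    divW (fun μ y ν y' => mixOfK K N M₂ ν y' μ y) y ν y' = 0 := by
  obtain ⟨δ, C, hδ, hC, hKd⟩ := hK
  have hT : ∀ (κ : Fin (d + 1)) (u : Site (d + 1)) (μ : Fin (d + 1)) (yy x z : Site (d + 1)) (a b : Fib d),
      |vertexOfM K N (M₂ κ u) μ yy x z a b| ≤ (d + 1 : ℕ) * (C * Zl (d + 1) δ * B) :=
    fun κ u μ yy x z a b => abs_vertexOfM_le (N := N) hKd hδ (hM₂ κ u) μ yy x z a b
  have hs : ∀ (μ : Fin (d + 1)) (yy : Site (d + 1)) (κ : Fin (d + 1)) (x z : Site (d + 1)) (a b : Fib d),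
      Summable fun u => colH K N ν y' κ u * vertexOfM K N (M₂ κ u) μ yy x z a b := fun μ yy κ x z a b =>
    Summable.of_norm_bounded ((summable_abs_colH (N := N) ⟨δ, C, hδ, hC, hKd⟩ ν y' κ).mul_right _) (fun u => by
      rw [Real.norm_eq_abs, abs_mul]; exact mul_le_mul_of_nonneg_left (hT κ u μ yy x z a b) (abs_nonneg _))
  have h0 : ∀ (κ : Fin (d + 1)) (u : Site (d + 1)), divV (vertexOfM K N (M₂ κ u)) y = 0 := fun κ u =>
    divV_vertexOfM_eq_zero (N := N) ⟨δ, C, hδ, hC, hKd⟩ hM0 (hM₂ κ u) y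
  funext x z a b
  simp only [KernelWard.divW, Finset.sum_apply, Pi.sub_apply, Pi.zero_apply, mixOfK, vertexOfK, OneStepResolventKernel.wsum]
  simp only [← Finset.sum_sub_distrib]
  rw [Finset.sum_comm]
  refine Finset.sum_eq_zero fun κ _ => ?_
  have e : ∀ μ : Fin (d + 1), (∑' u, colH K N ν y' κ u * vertexOfM K N (M₂ κ u) μ (y - unitVec μ) x z a b)
      - (∑' u, colH K N ν y' κ u * vertexOfM K N (M₂ κ u) μ y x z a b)
      = ∑' u, colH K N ν y' κ u * (vertexOfM K N (M₂ κ u) μ (y - unitVec μ) x z a b - vertexOfM K N (M₂ κ u) μ y x z a b) :=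
    fun μ => by
    rw [← (hs μ _ κ x z a b).tsum_sub (hs μ y κ x z a b)]
    exact tsum_congr fun u => by ring
  simp only [e]
  rw [← Summable.tsum_finsetSum (fun μ _ => (((hs μ (y - unitVec μ) κ x z a b).sub (hs μ y κ x z a b)).congr
    (fun u => by show _ - _ = _; ring)))]
  have e2 : ∀ u : Site (d + 1), ∑ μ, colH K N ν y' κ u
      * (vertexOfM K N (M₂ κ u) μ (y - unitVec μ) x z a b - vertexOfM K N (M₂ κ u) μ y x z a b) = 0 := fun u => by
    rw [← Finset.mul_sum]
    have h := congrFun (congrFun (congrFun (congrFun (h0 κ u) x) z) a) b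
    simp only [KernelWard.divV, Finset.sum_apply, Pi.sub_apply, Pi.zero_apply] at h
    rw [h, mul_zero]
  simp only [e2, tsum_zero]

end Carrier

/-! ## §4 Instances: the straight and the co-dressed step propagators of the wall, every level -/

section Instances

variable {Lc : ℕ} [NeZero Lc]

/-- [folklore] **THE MULTIPLIER-COLUMN VERTEX OF THE STRAIGHT STEP PROPAGATOR IS PURE-GAUGE TRANSVERSAL**, every level `j`, every bounded
table. -/
theorem divV_vertexOfM_KInvStep (j : ℕ) {M : Fin (d + 1) → Site (d + 1) → MKer (d + 1) (Fib d)} {B : ℝ}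
    (hM : ∀ ρ w x z a b, |M ρ w x z a b| ≤ B) (y : Site (d + 1)) :
    divV (vertexOfM (KInvStep (d := d) Lc j) Lc M) y = 0 :=
  divV_vertexOfM_eq_zero (decays_KInvStep (d := d) (Lc := Lc) j) (colM_KInvStep_ward j) hM y

/-- [folklore] **THE MULTIPLIER-COLUMN VERTEX OF THE CO-DRESSED WALL PROPAGATOR `G_j` IS PURE-GAUGE TRANSVERSAL**, every level `j`,
every in-block root `r`, every bounded table. -/
theorem divV_vertexOfM_coDressKBmAt_KInvStep {r : Fin (d + 1) → ℕ} (hr : r ∈ box (d + 1) Lc) (j : ℕ)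
    {M : Fin (d + 1) → Site (d + 1) → MKer (d + 1) (Fib d)} {B : ℝ} (hM : ∀ ρ w x z a b, |M ρ w x z a b| ≤ B)
    (y : Site (d + 1)) : divV (vertexOfM (coDressKBmAt (toSite r) Lc (KInvStep (d := d) Lc j)) Lc M) y = 0 :=
  divV_vertexOfM_eq_zero (decays_coDressKBmAt_KInvStep hr j) (colM_coDressKBmAt_KInvStep_ward (toSite r) j) hM y

/-- [folklore] **`divV dM = divV vertexOfK` FOR THE STRAIGHT STEP PROPAGATOR**, every level. -/
theorem divV_dM_KInvStep (j : ℕ) (S : Fin (d + 1) → Site (d + 1) → MKer (d + 1) (Fib d))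
    {M : Fin (d + 1) → Site (d + 1) → MKer (d + 1) (Fib d)} {B : ℝ} (hM : ∀ ρ w x z a b, |M ρ w x z a b| ≤ B)
    (y : Site (d + 1)) :
    divV (dM (KInvStep (d := d) Lc j) Lc S M) y = divV (vertexOfK (KInvStep (d := d) Lc j) Lc S) y :=
  divV_dM (decays_KInvStep (d := d) (Lc := Lc) j) (colM_KInvStep_ward j) S hM y

/-- [folklore] **`divV dM = divV vertexOfK` FOR THE CO-DRESSED WALL PROPAGATOR `G_j`**, every level, every in-block root. -/
theorem divV_dM_coDressKBmAt_KInvStep {r : Fin (d + 1) → ℕ} (hr : r ∈ box (d + 1) Lc) (j : ℕ)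
    (S : Fin (d + 1) → Site (d + 1) → MKer (d + 1) (Fib d)) {M : Fin (d + 1) → Site (d + 1) → MKer (d + 1) (Fib d)} {B : ℝ}
    (hM : ∀ ρ w x z a b, |M ρ w x z a b| ≤ B) (y : Site (d + 1)) :
    divV (dM (coDressKBmAt (toSite r) Lc (KInvStep (d := d) Lc j)) Lc S M) y
      = divV (vertexOfK (coDressKBmAt (toSite r) Lc (KInvStep (d := d) Lc j)) Lc S) y :=
  divV_dM (decays_coDressKBmAt_KInvStep hr j) (colM_coDressKBmAt_KInvStep_ward (toSite r) j) S hM y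

/-- [folklore] **THE EXCHANGED MIXED TERM OF `W2OfK` OVER THE STRAIGHT STEP PROPAGATOR IS PURE-GAUGE TRANSVERSAL IN ITS FIRST BOND**,
every level, every bounded mixed table. -/
theorem divW_mixOfK_swap_KInvStep (j : ℕ)
    {M₂ : Fin (d + 1) → Site (d + 1) → Fin (d + 1) → Site (d + 1) → MKer (d + 1) (Fib d)} {B : ℝ}
    (hM₂ : ∀ κ u ρ w x z a b, |M₂ κ u ρ w x z a b| ≤ B) (y : Site (d + 1)) (ν : Fin (d + 1)) (y' : Site (d + 1)) :
    divW (fun μ y ν y' => mixOfK (KInvStep (d := d) Lc j) Lc M₂ ν y' μ y) y ν y' = 0 :=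
  divW_mixOfK_swap_eq_zero (decays_KInvStep (d := d) (Lc := Lc) j) (colM_KInvStep_ward j) hM₂ y ν y'

/-- [folklore] **THE EXCHANGED MIXED TERM OF `W2OfK` OVER THE CO-DRESSED WALL PROPAGATOR `G_j` IS PURE-GAUGE TRANSVERSAL IN ITS FIRST
BOND**, every level, every in-block root, every bounded mixed table. -/
theorem divW_mixOfK_swap_coDressKBmAt_KInvStep {r : Fin (d + 1) → ℕ} (hr : r ∈ box (d + 1) Lc) (j : ℕ)
    {M₂ : Fin (d + 1) → Site (d + 1) → Fin (d + 1) → Site (d + 1) → MKer (d + 1) (Fib d)} {B : ℝ}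
    (hM₂ : ∀ κ u ρ w x z a b, |M₂ κ u ρ w x z a b| ≤ B) (y : Site (d + 1)) (ν : Fin (d + 1)) (y' : Site (d + 1)) :
    divW (fun μ y ν y' => mixOfK (coDressKBmAt (toSite r) Lc (KInvStep (d := d) Lc j)) Lc M₂ ν y' μ y) y ν y' = 0 :=
  divW_mixOfK_swap_eq_zero (decays_coDressKBmAt_KInvStep hr j) (colM_coDressKBmAt_KInvStep_ward (toSite r) j) hM₂ y ν y'

end Instances

end Summit.QuantumFields.BalabanUV.Beta.KernelWardMColumn

end
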